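import Summits.PneNP.PneNP.Theses.EcdlpDefinability
import Summits.PneNP.PneNP.Theorems.EcdlpDefinabilityEcdlpProgram
import Literature.Computability.Complexity.QuadraticCongruencesFactMachine
import Literature.Computability.Complexity.CanonicalCodes
import Literature.Computability.Complexity.ClayProblemProofs
import Literature.Computability.Complexity.PRelHierarchy
import Literature.Computability.Complexity.PromiseProofs
import Literature.Computability.Complexity.NondeterministicProofs

/-!
# Route EcdlpDefinability — `EcdlpInNP` (stmt-PneNP-2075)

The elliptic-curve discrete-logarithm language — codes of `[p, a₁, a₂, a₃, a₄, a₆, x_P, y_P, x_Q, y_Q, t]` with `p` prime,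
`P, Q` affine points of the elliptic `y² + a₁xy + a₃y = x³ + a₂x² + a₄x + a₆` over `𝔽_p` and `mP = Q` for some `m ≤ t` —
is in Cook's `NP` over `{0,1}`: certificate = `bin m` (`|bin m| ≤ |bin t| ≤ |input|`); the verifier canonicalises the
instance code (`canonListFnC`), decodes, tests primality (`PRIMES ∈ P`, `primeFn`), the two Weierstrass equations and
`Δ ≠ 0` on residues, `m ≤ t`, and runs double-and-add (`EcdlpDefinabilityEcdlpProgram`), whose result is Mathlib's
`m • P` (`EcdlpDefinabilityEcdlpArith`); `PNPWave0.NP Bool = NP` by `NP_bool_eq_holds`.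
-/

set_option linter.dupNamespace false -- `Summit.PneNP.PneNP.…`: summit = sub-problem name (D-0017 single-conjunct layout)

namespace Summit.PneNP.PneNP.Theorems

open _root_.Computability Polynomial
open Literature.Computability.Complexity Literature.Computability.Complexity.CodeFP
  Literature.Computability.Complexity.ModArith Literature.Computability.Complexity.Brick

/-! ### Residue tests read in `𝔽_p` -/

section Semantics

variable {p : ℕ} [Fact p.Prime]

/-- A canonical residue vanishes in `𝔽_p` iff it is `0`. [folklore] -/
theorem ecdlp_natCast_eq_zero_iff {x : ℕ} (hx : x < p) : (x : ZMod p) = 0 ↔ x = 0 := by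
  rw [← Nat.cast_zero, ecdlp_natCast_inj hx (Fact.out : p.Prime).pos]

omit [Fact p.Prime] in
/-- Sums of residues are canonical. [folklore] -/
theorem ecdlp_addM_lt (hp : 0 < p) (a b : ℕ) : addM p a b < p := Nat.mod_lt _ hp

/-- **The residue equation test is the Weierstrass equation.** [cite: SilvermanAEC2009, III.1] -/
theorem ecdlp_equation_iff (a₁ a₂ a₃ a₄ a₆ x y : ℕ) :
    addM p (addM p (mulM p y y) (mulM p (mulM p a₁ x) y)) (mulM p a₃ y) =
        addM p (addM p (addM p (mulM p (mulM p x x) x) (mulM p a₂ (mulM p x x))) (mulM p a₄ x)) a₆ ↔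
      (⟨(a₁ : ZMod p), (a₂ : ZMod p), (a₃ : ZMod p), (a₄ : ZMod p), (a₆ : ZMod p)⟩ : WeierstrassCurve (ZMod p)).toAffine.Equation
        (x : ZMod p) (y : ZMod p) := by
  have hp : 0 < p := (Fact.out : p.Prime).pos
  rw [← ecdlp_natCast_inj (ecdlp_addM_lt hp _ _) (ecdlp_addM_lt hp _ _), WeierstrassCurve.Affine.equation_iff]
  simp only [natCast_addM, natCast_mulM]
  constructor
  · intro h; linear_combination h
  · intro h; linear_combination h

/-- **The residue discriminant test is `Δ ≠ 0`.** [cite: SilvermanAEC2009, III.1] -/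
theorem ecdlp_delta_ne_zero_iff (a₁ a₂ a₃ a₄ a₆ : ℕ) :
    (let b₂ := addM p (mulM p a₁ a₁) (mulM p 4 a₂); let b₄ := addM p (mulM p 2 a₄) (mulM p a₁ a₃)
     let b₆ := addM p (mulM p a₃ a₃) (mulM p 4 a₆)
     let b₈ := subM p (addM p (subM p (addM p (mulM p (mulM p a₁ a₁) a₆) (mulM p (mulM p 4 a₂) a₆))
       (mulM p (mulM p a₁ a₃) a₄)) (mulM p a₂ (mulM p a₃ a₃))) (mulM p a₄ a₄)
     addM p (subM p (subM p (negM p (mulM p (mulM p b₂ b₂) b₈)) (mulM p 8 (mulM p (mulM p b₄ b₄) b₄)))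
       (mulM p 27 (mulM p b₆ b₆))) (mulM p 9 (mulM p (mulM p b₂ b₄) b₆)) ≠ 0) ↔
      (⟨(a₁ : ZMod p), (a₂ : ZMod p), (a₃ : ZMod p), (a₄ : ZMod p), (a₆ : ZMod p)⟩ : WeierstrassCurve (ZMod p)).Δ ≠ 0 := by
  have hp : 0 < p := (Fact.out : p.Prime).pos
  dsimp only
  rw [Ne, ← ecdlp_natCast_eq_zero_iff (ecdlp_addM_lt hp _ _)]
  simp only [natCast_addM, natCast_mulM, natCast_subM, natCast_negM, WeierstrassCurve.Δ, WeierstrassCurve.b₂,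
    WeierstrassCurve.b₄, WeierstrassCurve.b₆, WeierstrassCurve.b₈]
  push_cast
  constructor
  · intro h h'; apply h; linear_combination h'
  · intro h h'; apply h; linear_combination h'

omit [Fact p.Prime] in
/-- A represented point determines its triple. [folklore] -/
theorem ecdlp_pt_inj (W : WeierstrassCurve.Affine (ZMod p)) {u v : ℕ × ℕ × ℕ} {R : W.Point} (hu : ecdlpPt W u = some R)
    (hv : ecdlpPt W v = some R) : u = v := by
  rcases ecdlp_pt_eq_some W hu with ⟨rfl, rfl⟩ | ⟨x, y, rfl, hx, hy, n, rfl⟩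
  · rcases ecdlp_pt_eq_some W hv with ⟨rfl, -⟩ | ⟨x', y', rfl, -, -, n', h⟩
    · rfl
    · exact absurd h.symm (WeierstrassCurve.Affine.Point.some_ne_zero n')
  · rcases ecdlp_pt_eq_some W hv with ⟨rfl, h⟩ | ⟨x', y', rfl, hx', hy', n', h⟩
    · exact absurd h (WeierstrassCurve.Affine.Point.some_ne_zero n)
    · obtain ⟨h1, h2⟩ := WeierstrassCurve.Affine.Point.some.inj h
      rw [(ecdlp_natCast_inj hx hx').1 h1, (ecdlp_natCast_inj hy hy').1 h2]

end Semantics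

/-! ### `NP` membership -/

/-- A list of length `11` is an eleven-entry list. [folklore] -/
theorem ecdlp_list_eq_of_length {l : List ℕ} (h : l.length = 11) :
    ∃ a0 a1 a2 a3 a4 a5 a6 a7 a8 a9 a10 : ℕ, l = [a0, a1, a2, a3, a4, a5, a6, a7, a8, a9, a10] := by
  obtain ⟨a0, l, rfl⟩ := List.exists_of_length_succ l h
  obtain ⟨a1, l, rfl⟩ := List.exists_of_length_succ l (by simpa using h)
  obtain ⟨a2, l, rfl⟩ := List.exists_of_length_succ l (by simpa using h)
  obtain ⟨a3, l, rfl⟩ := List.exists_of_length_succ l (by simpa using h)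
  obtain ⟨a4, l, rfl⟩ := List.exists_of_length_succ l (by simpa using h)
  obtain ⟨a5, l, rfl⟩ := List.exists_of_length_succ l (by simpa using h)
  obtain ⟨a6, l, rfl⟩ := List.exists_of_length_succ l (by simpa using h)
  obtain ⟨a7, l, rfl⟩ := List.exists_of_length_succ l (by simpa using h)
  obtain ⟨a8, l, rfl⟩ := List.exists_of_length_succ l (by simpa using h)
  obtain ⟨a9, l, rfl⟩ := List.exists_of_length_succ l (by simpa using h)
  obtain ⟨a10, l, rfl⟩ := List.exists_of_length_succ l (by simpa using h)
  have hl : l = [] := List.eq_nil_of_length_eq_zero (by simpa using h)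
  subst hl
  exact ⟨a0, a1, a2, a3, a4, a5, a6, a7, a8, a9, a10, rfl⟩

/-- **stmt-PneNP-2075** `EcdlpInNP`: the elliptic-curve discrete-logarithm language is in Cook's `NP` over `{0,1}`.
[cite: CookClay2006, §1] [cite: AroraBarakCC2009, Def. 2.1] -/
theorem ecdlpDefinability_ecdlpInNP_proof : Summit.PneNP.PneNP.Theses.EcdlpDefinability.EcdlpInNP := by
  classical
  unfold Summit.PneNP.PneNP.Theses.EcdlpDefinability.EcdlpInNP
  rw [show PNPWave0.NP Bool = Nondeterministic.NP from NP_bool_eq_holds]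
  -- primality on codes (`PRIMES ∈ P`)
  have hπ : CodeFP natE bitE fun n : ℕ => decide n.Prime :=
    CodeFP.of_fn QuadCongNP.primeFn QuadCongNP.primeFn_mem_FP fun n => QuadCongFP.primeFn_encodeNat n
  obtain ⟨τ, hτ, hspec⟩ := ecdlp_exists_codeTest hπ
  -- decoding the instance and the certificate
  have hcan : ∀ c : List Bool,
      encodingNatBool.listBool.decode c = some (NegCNF.decList decodeNat (boolUnpair c).1.length (boolUnpair c).2) ∧
        CanonCode.canonListFnC 2 canonF c =
          encodingNatBool.listBool.encode (NegCNF.decList decodeNat (boolUnpair c).1.length (boolUnpair c).2) :=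
    fun c => CanonCode.canonListFnC_eq encodingNatBool decodeNat (fun _ => rfl) canonF_eq_encodeNat_decodeNat
      (A := 1) (B := 1) (fun u => by have := length_canonF_le u; omega) (by norm_num) c
  have hdecode : ∀ l : List ℕ, NegCNF.decList decodeNat (boolUnpair (encodingNatBool.listBool.encode l)).1.length
      (boolUnpair (encodingNatBool.listBool.encode l)).2 = l := fun l => by
    have h := (hcan (encodingNatBool.listBool.encode l)).1
    rw [encodingNatBool.listBool.decode_encode] at h
    exact (Option.some.inj h).symm
  have hfst : CodeFP strE strE fun w : List Bool => fstF w := CodeFP.of_fn fstF fstF_mem_FP fun _ => rfl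
  have hcanC : CodeFP strE strE fun w : List Bool => CanonCode.canonListFnC 2 canonF (fstF w) :=
    CodeFP.of_fn (CanonCode.canonListFnC 2 canonF ∘ fstF) (comp_mem_FP (CanonCode.canonListFnC_mem_FP 2 canonF_mem_FP) fstF_mem_FP)
      fun _ => rfl
  have hlist : CodeFP strE (rawE natE) fun w : List Bool => NegCNF.decList decodeNat (boolUnpair (fstF w)).1.length (boolUnpair (fstF w)).2 := by
    refine (rawOfList natE).comp (hcanC.recodeOut fun w => ?_)
    rw [(hcan (fstF w)).2, listE_eq]
    rfl
  have hcert : CodeFP strE natE fun w : List Bool => decodeNat (sndF w) :=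
    CodeFP.of_fn (canonF ∘ sndF) (comp_mem_FP canonF_mem_FP sndF_mem_FP) fun w => canonF_eq_encodeNat_decodeNat _
  have hcode : CodeFP strE bitE fun w : List Bool => decide (CanonCode.canonListFnC 2 canonF (fstF w) = fstF w) :=
    ((CodeFP.eq (α := List Bool) (eα := strE) Function.injective_id).comp (hcanC.pair hfst) :)
  obtain ⟨g, hg, hgspec⟩ := hcode.and ((hτ.comp (hlist.pair hcert) :))
  -- the verifier language
  set V : Language Bool := g ⁻¹' PRelSigma.HeadIs true with hV
  have hVP : V ∈ Classes.P := preimage_mem_P (PRelSigma.HeadIs_mem_P true) hg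
  have hVsem : ∀ z y : List Bool, boolPair z y ∈ V ↔ CanonCode.canonListFnC 2 canonF z = z ∧
      τ (NegCNF.decList decodeNat (boolUnpair z).1.length (boolUnpair z).2, decodeNat y) = true := by
    intro z y
    change g (boolPair z y) ∈ PRelSigma.HeadIs true ↔ _
    rw [PRelSigma.mem_HeadIs, show g (boolPair z y) = g (strE (boolPair z y)) from rfl, hgspec]
    simp [bitE, fstF_boolPair, sndF_boolPair]
  refine ⟨V, hVP, Polynomial.X, fun z => ?_⟩
  rw [eval_X]
  constructor
  · -- completeness
    rintro ⟨l, hl, rfl⟩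
    obtain ⟨p, a₁, a₂, a₃, a₄, a₆, xp, yp, xq, yq, t, rfl, hp, hP, hQ, hΔ, m, hm, hmul⟩ := hl
    haveI : Fact p.Prime := ⟨hp⟩
    have hp2 : max p 2 = p := max_eq_left hp.two_le
    have hp0 : 0 < p := hp.pos
    refine ⟨encodeNat m, ?_, ?_⟩
    · -- `|bin m| ≤ |bin t| ≤ |code|`
      have h1 : (encodeNat m).length ≤ (encodeNat t).length := length_natE_mono hm
      have h2 := length_item_le_length_rawE natE (show t ∈ [p, a₁, a₂, a₃, a₄, a₆, xp, yp, xq, yq, t] by simp)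
      have h3 : (encodingListNatBool.encode [p, a₁, a₂, a₃, a₄, a₆, xp, yp, xq, yq, t] : List Bool) =
          boolPair (unE 11) (rawE natE [p, a₁, a₂, a₃, a₄, a₆, xp, yp, xq, yq, t]) := congrFun (listE_eq encodingNatBool) _
      rw [h3, length_boolPair]
      change 2 * (encodeNat t).length + 2 ≤ _ at h2
      omega
    · rw [hVsem]
      refine ⟨?_, ?_⟩
      · rw [(hcan _).2]
        exact congrArg _ (hdecode _)
      rw [show (encodingListNatBool.encode [p, a₁, a₂, a₃, a₄, a₆, xp, yp, xq, yq, t] : List Bool) =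
        encodingNatBool.listBool.encode [p, a₁, a₂, a₃, a₄, a₆, xp, yp, xq, yq, t] from rfl, hdecode, decode_encodeNat, hspec]
      simp only [List.getD_cons_zero, List.getD_cons_succ, List.length_cons, List.length_nil, decide_eq_true_eq, hp2,
        List.mem_cons, List.not_mem_nil, or_false, forall_eq_or_imp, forall_eq]
      refine ⟨⟨trivial, hp, hm⟩, ⟨(ecdlp_equation_iff a₁ a₂ a₃ a₄ a₆ xp yp).2 hP.1, (ecdlp_equation_iff a₁ a₂ a₃ a₄ a₆ xq yq).2 hQ.1⟩,
        (ecdlp_delta_ne_zero_iff a₁ a₂ a₃ a₄ a₆).2 hΔ, ?_⟩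
      -- double-and-add reaches `Q`
      have hP' := hP
      rw [← ZMod.natCast_mod xp p, ← ZMod.natCast_mod yp p] at hP'
      have hQ' := hQ
      rw [← ZMod.natCast_mod xq p, ← ZMod.natCast_mod yq p] at hQ'
      have hu := ecdlp_pt_affine _ (Nat.mod_lt _ hp0) (Nat.mod_lt _ hp0) hP'
      have hv := ecdlp_pt_affine _ (Nat.mod_lt _ hp0) (Nat.mod_lt _ hp0) hQ'
      have hsm := ecdlp_pt_smul _ rfl rfl rfl rfl (B := (natE m).length + 1)
        ((lt_two_pow_length_natE m).trans_le (Nat.pow_le_pow_right (by norm_num) (Nat.le_succ _))) hu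
      refine ecdlp_pt_inj _ hsm ?_
      rw [hv]
      congr 1
      have e1 : WeierstrassCurve.Affine.Point.some _ _ hP' = WeierstrassCurve.Affine.Point.some _ _ hP := by
        simp only [ZMod.natCast_mod]
      have e2 : WeierstrassCurve.Affine.Point.some _ _ hQ' = WeierstrassCurve.Affine.Point.some _ _ hQ := by
        simp only [ZMod.natCast_mod]
      rw [e1, e2, hmul]
  · -- soundness
    rintro ⟨y, -, hy⟩
    rw [hVsem] at hy
    obtain ⟨hcodez, hτ'⟩ := hy
    set l := NegCNF.decList decodeNat (boolUnpair z).1.length (boolUnpair z).2 with hl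
    have hz : encodingListNatBool.encode l = z := by
      rw [show (encodingListNatBool.encode l : List Bool) = encodingNatBool.listBool.encode l from rfl, ← (hcan z).2, hcodez]
    refine ⟨l, ?_, hz⟩
    rw [hspec] at hτ'
    obtain ⟨⟨hlen, hprime, hmt⟩, heqs, hΔ', hsm⟩ := hτ'
    rw [decide_eq_true_eq] at hprime
    haveI : Fact (l.getD 0 0).Prime := ⟨hprime⟩
    have hp2 : max (l.getD 0 0) 2 = l.getD 0 0 := max_eq_left hprime.two_le
    have hp0 : 0 < l.getD 0 0 := hprime.pos
    simp only [List.mem_cons, List.not_mem_nil, or_false, forall_eq_or_imp, forall_eq, hp2] at heqs hΔ' hsm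
    obtain ⟨he1, he2⟩ := heqs
    obtain ⟨b0, b1, b2, b3, b4, b5, b6, b7, b8, b9, b10, hlb⟩ := ecdlp_list_eq_of_length hlen
    have hl' : l = [l.getD 0 0, l.getD 1 0, l.getD 2 0, l.getD 3 0, l.getD 4 0, l.getD 5 0, l.getD 6 0, l.getD 7 0, l.getD 8 0,
        l.getD 9 0, l.getD 10 0] := by
      conv_lhs => rw [hlb]
      simp [hlb]
    refine ⟨l.getD 0 0, l.getD 1 0, l.getD 2 0, l.getD 3 0, l.getD 4 0, l.getD 5 0, l.getD 6 0, l.getD 7 0, l.getD 8 0,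
      l.getD 9 0, l.getD 10 0, hl', hprime, ?_⟩
    have hΔ := (ecdlp_delta_ne_zero_iff (l.getD 1 0) (l.getD 2 0) (l.getD 3 0) (l.getD 4 0) (l.getD 5 0)).1 hΔ'
    have hP := (WeierstrassCurve.Affine.equation_iff_nonsingular_of_Δ_ne_zero hΔ).1
      ((ecdlp_equation_iff (l.getD 1 0) (l.getD 2 0) (l.getD 3 0) (l.getD 4 0) (l.getD 5 0) (l.getD 6 0) (l.getD 7 0)).1 he1)
    have hQ := (WeierstrassCurve.Affine.equation_iff_nonsingular_of_Δ_ne_zero hΔ).1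
      ((ecdlp_equation_iff (l.getD 1 0) (l.getD 2 0) (l.getD 3 0) (l.getD 4 0) (l.getD 5 0) (l.getD 8 0) (l.getD 9 0)).1 he2)
    refine ⟨hP, hQ, hΔ, decodeNat y, hmt, ?_⟩
    have hP' := hP
    rw [← ZMod.natCast_mod (l.getD 6 0) (l.getD 0 0), ← ZMod.natCast_mod (l.getD 7 0) (l.getD 0 0)] at hP'
    have hQ' := hQ
    rw [← ZMod.natCast_mod (l.getD 8 0) (l.getD 0 0), ← ZMod.natCast_mod (l.getD 9 0) (l.getD 0 0)] at hQ'
    have hu := ecdlp_pt_affine _ (Nat.mod_lt _ hp0) (Nat.mod_lt _ hp0) hP'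
    have hv := ecdlp_pt_affine _ (Nat.mod_lt _ hp0) (Nat.mod_lt _ hp0) hQ'
    have hsm' := ecdlp_pt_smul _ rfl rfl rfl rfl (B := (natE (decodeNat y)).length + 1)
      ((lt_two_pow_length_natE (decodeNat y)).trans_le (Nat.pow_le_pow_right (by norm_num) (Nat.le_succ _))) hu
    rw [hsm, hv] at hsm'
    have e := Option.some.inj hsm'
    have e1 : WeierstrassCurve.Affine.Point.some _ _ hP' = WeierstrassCurve.Affine.Point.some _ _ hP := by
      simp only [ZMod.natCast_mod]
    have e2 : WeierstrassCurve.Affine.Point.some _ _ hQ' = WeierstrassCurve.Affine.Point.some _ _ hQ := by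
      simp only [ZMod.natCast_mod]
    rw [← e1, ← e2]
    exact e.symm

end Summit.PneNP.PneNP.Theorems
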